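import Summits.CriticalPhenomena.Ising3DConformalLimit.Theses.OctaveForgetting
import Literature.Probability.LatticeModels.CriticalTwoPointBounds
import Literature.Probability.LatticeModels.CriticalGibbsUniqueness
import Literature.Probability.LatticeModels.PlusMinusStateGibbs
import Literature.Probability.LatticeModels.MessagerMiracleSole
import Literature.Probability.LatticeModels.GKSInequalities
import Literature.Probability.LatticeModels.GriffithsMonotonicity
import HarnessLib

/-!
# Route OctaveForgetting — `SphereCovarianceLowerBound` (item stmt-CriticalPhenomena-8105)

The covariance half of the card's lemma (L2): there are `c > 0` and `R₀` with
`Cov_μ(σ₀, Σ_{y ∈ S_R} σ_y) ≥ c · R² · ⟨σ₀σ_{3R e₁}⟩_{β_c(3)}` for all `R ≥ R₀` and every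
`μ ∈ 𝒢(β_c(3), 0)`, where `S_R = {y ∈ Λ_R : R² ≤ |y|² < (R+1)²}` is the lattice sphere.

Proof (as in the item text): `𝒢(β_c(3), 0)` is a singleton
(`hasUniqueGibbsMeasure_criticalBeta_holds`), its element is the plus state
(`exists_plusMeasure_holds`), so `⟨σ₀⟩_μ = m*(β_c) = 0`
(`spontaneousMagnetization_criticalBeta_eq_zero_holds`) and `⟨σ₀σ_y⟩_μ = ⟨σ₀σ_y⟩⁺_{β_c}`; by
Messager–Miracle-Solé (`twoPointFree_le_of_mul_supNorm_le` with `⟨·⟩⁺ = ⟨·⟩^f` at `β_c`),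
`⟨σ₀σ_y⟩ ≥ ⟨σ₀σ_{3R e₁}⟩` for `‖y‖_∞ ≤ R`; and `|S_R| ≥ (⌊R/2⌋ + 1)² ≥ R²/4` because
`(a, b) ↦ (a, b, ⌊√(R² − a² − b² − 1)⌋ + 1)` injects `{0, …, ⌊R/2⌋}²` into `S_R`. Constants:
`c = 1/4`, `R₀ = 1`.
-/

namespace Summit.CriticalPhenomena.Ising3DConformalLimit.Theorems

open MeasureTheory Finset Literature.Probability.LatticeModels
open scoped BigOperators

/-- **The third coordinate of the injection `{0,…,⌊R/2⌋}² → S_R`.** For `2a ≤ R`, `2b ≤ R`,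
`1 ≤ R`, the least `c ≥ 1` with `a² + b² + c² ≥ R²`, namely `c = ⌊√(R² − a² − b² − 1)⌋ + 1`,
satisfies `R² ≤ a² + b² + c² < (R+1)²` and `c ≤ R` (consecutive squares below `R²` differ by at
most `2R + 1`). -/
private theorem thirdCoord_spec {R a b : ℕ} (hR : 1 ≤ R) (ha : 2 * a ≤ R) (hb : 2 * b ≤ R) :
    R ^ 2 ≤ a ^ 2 + b ^ 2 + (Nat.sqrt (R ^ 2 - a ^ 2 - b ^ 2 - 1) + 1) ^ 2 ∧
      a ^ 2 + b ^ 2 + (Nat.sqrt (R ^ 2 - a ^ 2 - b ^ 2 - 1) + 1) ^ 2 < (R + 1) ^ 2 ∧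
        Nat.sqrt (R ^ 2 - a ^ 2 - b ^ 2 - 1) + 1 ≤ R := by
  have ha2 : 4 * a ^ 2 ≤ R ^ 2 := by nlinarith
  have hb2 : 4 * b ^ 2 ≤ R ^ 2 := by nlinarith
  have hlt : a ^ 2 + b ^ 2 < R ^ 2 := by nlinarith
  set m : ℕ := R ^ 2 - a ^ 2 - b ^ 2 with hm
  have hm1 : 1 ≤ m := by omega
  have hmR : a ^ 2 + b ^ 2 + m = R ^ 2 := by omega
  set s : ℕ := Nat.sqrt (m - 1) with hs
  have hs1 : s ^ 2 ≤ m - 1 := Nat.sqrt_le' (m - 1)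
  have hs2 : m - 1 < (s + 1) ^ 2 := Nat.lt_succ_sqrt' (m - 1)
  have hsR : s ≤ R := by
    have : s ≤ Nat.sqrt (R ^ 2) := Nat.sqrt_le_sqrt (by omega)
    rwa [Nat.sqrt_eq' R] at this
  refine ⟨by omega, ?_, ?_⟩
  · have : (s + 1) ^ 2 ≤ m + 2 * s := by
      have : (s + 1) ^ 2 = s ^ 2 + 2 * s + 1 := by ring
      omega
    nlinarith
  · -- `(s+1)² ≤ m + 2s ≤ R² + 2R < (R+1)²`, hence `s + 1 ≤ R`
    have h1 : (s + 1) ^ 2 < (R + 1) ^ 2 := by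
      have : (s + 1) ^ 2 ≤ m + 2 * s := by
        have : (s + 1) ^ 2 = s ^ 2 + 2 * s + 1 := by ring
        omega
      nlinarith
    have : s + 1 < R + 1 := lt_of_pow_lt_pow_left₀ 2 (by omega) h1
    omega

/-- **Lattice-point count on the sphere**: `|S_R| ≥ R²/4` for `R ≥ 1`, where
`S_R = {y ∈ Λ_R : R² ≤ |y|² < (R+1)²}`: the map `(a, b) ↦ (a, b, ⌊√(R² − a² − b² − 1)⌋ + 1)`
injects `{0, …, ⌊R/2⌋}²` into `S_R`, and `(⌊R/2⌋ + 1)² ≥ R²/4`. -/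
private theorem sq_div_four_le_card_latticeSphere {R : ℕ} (hR : 1 ≤ R) :
    (R : ℝ) ^ 2 / 4 ≤ #((box 3 R).filter
      (fun y => (R : ℤ) ^ 2 ≤ ∑ i, y i ^ 2 ∧ ∑ i, y i ^ 2 < ((R : ℤ) + 1) ^ 2)) := by
  set S : Finset (Site 3) := (box 3 R).filter
    (fun y => (R : ℤ) ^ 2 ≤ ∑ i, y i ^ 2 ∧ ∑ i, y i ^ 2 < ((R : ℤ) + 1) ^ 2) with hS
  set D : Finset (ℕ × ℕ) := (range (R / 2 + 1)) ×ˢ (range (R / 2 + 1)) with hD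
  -- the injection `(a, b) ↦ (a, b, ⌊√(R² − a² − b² − 1)⌋ + 1)`
  set φ : ℕ × ℕ → Site 3 := fun p =>
    ![(p.1 : ℤ), (p.2 : ℤ), ((Nat.sqrt (R ^ 2 - p.1 ^ 2 - p.2 ^ 2 - 1) + 1 : ℕ) : ℤ)] with hφ
  have hmaps : ∀ p ∈ D, φ p ∈ S := by
    rintro ⟨a, b⟩ hp
    simp only [hD, mem_product, mem_range] at hp
    have ha : 2 * a ≤ R := by omega
    have hb : 2 * b ≤ R := by omega
    obtain ⟨h1, h2, h3⟩ := thirdCoord_spec hR ha hb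
    have haR : a ≤ R := by omega
    have hbR : b ≤ R := by omega
    simp only [hS, hφ, mem_filter, mem_box, Fin.sum_univ_three, Matrix.cons_val_zero,
      Matrix.cons_val_one, Matrix.cons_val]
    refine ⟨?_, ?_, ?_⟩
    · intro i
      fin_cases i <;> simp <;> omega
    · exact_mod_cast h1
    · exact_mod_cast h2
  have hinj : Set.InjOn φ D := by
    rintro ⟨a, b⟩ - ⟨a', b'⟩ - h
    simp only [hφ] at h
    have h0 := congr_fun h 0
    have h1 := congr_fun h 1
    simp only [Matrix.cons_val_zero, Matrix.cons_val_one, Nat.cast_inj] at h0 h1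
    simp [h0, h1]
  have hcard : #D ≤ #S := card_le_card_of_injOn φ hmaps hinj
  have hD' : #D = (R / 2 + 1) ^ 2 := by
    rw [hD, card_product, card_range, sq]
  have hhalf : (R : ℝ) / 2 ≤ ((R / 2 + 1 : ℕ) : ℝ) := by
    have h : R < 2 * (R / 2 + 1) := by omega
    have h' : (R : ℝ) < 2 * ((R / 2 + 1 : ℕ) : ℝ) := by exact_mod_cast h
    linarith
  calc (R : ℝ) ^ 2 / 4 = ((R : ℝ) / 2) ^ 2 := by ring
    _ ≤ ((R / 2 + 1 : ℕ) : ℝ) ^ 2 := by gcongr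
    _ = ((#D : ℕ) : ℝ) := by rw [hD']; push_cast; ring
    _ ≤ #S := by exact_mod_cast hcard

/-- Points of the lattice sphere `S_R` are not the origin (for `R ≥ 1`). -/
private theorem ne_zero_of_mem_latticeSphere {R : ℕ} (hR : 1 ≤ R) {y : Site 3}
    (hy : y ∈ (box 3 R).filter
      (fun y => (R : ℤ) ^ 2 ≤ ∑ i, y i ^ 2 ∧ ∑ i, y i ^ 2 < ((R : ℤ) + 1) ^ 2)) : y ≠ 0 := by
  rintro rfl
  simp only [mem_filter, Pi.zero_apply] at hy
  have h := hy.2.1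
  simp at h
  have : (1 : ℤ) ≤ R := by exact_mod_cast hR
  nlinarith

/-- **Messager–Miracle-Solé on the sphere**: `⟨σ₀σ_{3R e₁}⟩_{β_c} ≤ ⟨σ₀σ_y⟩_{β_c}` for `y ∈ Λ_R`
(`3‖y‖_∞ ≤ 3R = ‖3R e₁‖_∞`; tree: `twoPointFree_le_of_mul_supNorm_le` and `⟨·⟩⁺ = ⟨·⟩^f` at
`β_c(3)`). -/
private theorem criticalTwoPoint_axis_le_of_mem_box {R : ℕ} {y : Site 3} (hy : y ∈ box 3 R) :
    criticalTwoPoint 3 (Pi.single 0 (3 * (R : ℤ))) ≤ criticalTwoPoint 3 y := by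
  have hyR : Site.supNorm y ≤ R := mem_box_iff_supNorm_le.1 hy
  have hz : 3 * R ≤ Site.supNorm (Pi.single 0 (3 * (R : ℤ)) : Site 3) := by
    have h := Site.natAbs_le_supNorm (Pi.single 0 (3 * (R : ℤ)) : Site 3) 0
    simp only [Pi.single_eq_same] at h
    have : (3 * (R : ℤ)).natAbs = 3 * R := by
      rw [show (3 * (R : ℤ)) = ((3 * R : ℕ) : ℤ) by push_cast; ring, Int.natAbs_natCast]
    omega
  have h : 3 * Site.supNorm y ≤ Site.supNorm (Pi.single 0 (3 * (R : ℤ)) : Site 3) := by omega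
  have hβ := criticalBeta_nonneg 3
  have h1 := twoPointFree_le_of_mul_supNorm_le (d := 3) hβ (by norm_num) h
  have heq := twoPointPlus_criticalBeta_eq_twoPointFree_holds (d := 3) (by norm_num)
  show twoPointPlus 3 (criticalBeta 3) _ ≤ twoPointPlus 3 (criticalBeta 3) y
  rw [heq, heq y]
  exact h1

/-- **Identification of the critical state.** Every `μ ∈ 𝒢(β_c(3), 0)` is the plus state: a
probability measure with `⟨σ_A⟩_μ = ⟨σ_A⟩⁺_{β_c(3),0}` for every finite `A`
(`hasUniqueGibbsMeasure_criticalBeta_holds`, `exists_plusMeasure_holds`). -/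
private theorem spinCorr_eq_plusCorr_of_mem_critical {μ : Measure (SpinConfig (Site 3))}
    (hμ : μ ∈ isingGibbsMeasures 3 (criticalBeta 3) 0) :
    IsProbabilityMeasure μ ∧ ∀ A : Finset (Site 3), spinCorr μ A = plusCorr 3 (criticalBeta 3) 0 A := by
  obtain ⟨μp, hμp, -, hcorr⟩ :=
    exists_plusMeasure_holds (d := 3) (β := criticalBeta 3) (h := (0 : ℝ)) (criticalBeta_nonneg 3)
  have huniq := hasUniqueGibbsMeasure_criticalBeta_holds (d := 3) (by norm_num)
  have hμeq : μ = μp := huniq.1 hμ hμp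
  subst hμeq
  exact ⟨((mem_isingGibbsMeasures_iff 3 _ 0 μ).1 hμ).isProbabilityMeasure, hcorr⟩

/-- `⟨σ₀⟩_μ = m*(β_c(3)) = 0` for the critical state. -/
private theorem integral_spinAt_zero_eq_zero {μ : Measure (SpinConfig (Site 3))}
    (hμ : μ ∈ isingGibbsMeasures 3 (criticalBeta 3) 0) :
    ∫ σ, spinAt 0 σ ∂μ = 0 := by
  obtain ⟨-, hcorr⟩ := spinCorr_eq_plusCorr_of_mem_critical hμ
  have h := hcorr {0}
  rw [spinCorr, spinProduct_singleton, ← spontaneousMagnetization_eq_plusCorr,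
    spontaneousMagnetization_criticalBeta_eq_zero_holds (d := 3) (by norm_num)] at h
  exact h

/-- `⟨σ₀σ_y⟩_μ = ⟨σ₀σ_y⟩⁺_{β_c(3)}` for the critical state and `y ≠ 0`. -/
private theorem integral_spinAt_zero_mul_eq_criticalTwoPoint {μ : Measure (SpinConfig (Site 3))}
    (hμ : μ ∈ isingGibbsMeasures 3 (criticalBeta 3) 0) {y : Site 3} (hy : y ≠ 0) :
    ∫ σ, spinAt 0 σ * spinAt y σ ∂μ = criticalTwoPoint 3 y := by
  obtain ⟨-, hcorr⟩ := spinCorr_eq_plusCorr_of_mem_critical hμ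
  have h := hcorr {0, y}
  rw [← twoPointPlus_eq_plusCorr_pair _ hy, spinCorr] at h
  have hprod : (spinProduct ({0, y} : Finset (Site 3))) = fun σ => spinAt 0 σ * spinAt y σ := by
    funext σ
    simp [spinProduct, Finset.prod_insert, Ne.symm hy]
  rw [hprod] at h
  exact h

/-- **Item stmt-CriticalPhenomena-8105 (`SphereCovarianceLowerBound`), proved** with `c = 1/4`,
`R₀ = 1`: for every `R ≥ 1` and `μ ∈ 𝒢(β_c(3), 0)`,
`(1/4) R² ⟨σ₀σ_{3R e₁}⟩_{β_c(3)} ≤ Cov_μ(σ₀, Σ_{y ∈ S_R} σ_y)`. -/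
theorem SphereCovarianceLowerBound_proof :
    Summit.CriticalPhenomena.Ising3DConformalLimit.Theses.OctaveForgetting.SphereCovarianceLowerBound := by
  unfold Summit.CriticalPhenomena.Ising3DConformalLimit.Theses.OctaveForgetting.SphereCovarianceLowerBound
  refine ⟨1 / 4, by norm_num, 1, le_rfl, fun R hR μ hμ => ?_⟩
  set S : Finset (Site 3) := (box 3 R).filter
    (fun y => (R : ℤ) ^ 2 ≤ ∑ i, y i ^ 2 ∧ ∑ i, y i ^ 2 < ((R : ℤ) + 1) ^ 2) with hS
  obtain ⟨hP, -⟩ := spinCorr_eq_plusCorr_of_mem_critical hμ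
  -- the product term vanishes: `⟨σ₀⟩ = 0`
  rw [integral_spinAt_zero_eq_zero hμ, zero_mul, sub_zero]
  -- the mixed moment is the sum of two-point functions
  have hsum : ∫ σ, spinAt 0 σ * ∑ y ∈ S, spinAt y σ ∂μ = ∑ y ∈ S, criticalTwoPoint 3 y := by
    simp_rw [Finset.mul_sum]
    rw [integral_finsetSum _ fun y _ => ?_]
    · exact Finset.sum_congr rfl fun y hy =>
        integral_spinAt_zero_mul_eq_criticalTwoPoint hμ (ne_zero_of_mem_latticeSphere hR hy)
    · exact Integrable.of_bound ((measurable_spinAt 0).mul (measurable_spinAt y)).aestronglyMeasurable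
        1 (Filter.Eventually.of_forall fun σ => by
          rw [Real.norm_eq_abs, abs_mul, abs_spinAt, abs_spinAt, mul_one])
  rw [hsum]
  have hG0 : 0 ≤ criticalTwoPoint 3 (Pi.single 0 (3 * (R : ℤ))) :=
    twoPointPlus_nonneg_of_gks (criticalBeta_nonneg 3) _
  calc 1 / 4 * (R : ℝ) ^ 2 * criticalTwoPoint 3 (Pi.single 0 (3 * (R : ℤ)))
      = (R : ℝ) ^ 2 / 4 * criticalTwoPoint 3 (Pi.single 0 (3 * (R : ℤ))) := by ring
    _ ≤ #S * criticalTwoPoint 3 (Pi.single 0 (3 * (R : ℤ))) := by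
        gcongr
        exact sq_div_four_le_card_latticeSphere hR
    _ = ∑ _y ∈ S, criticalTwoPoint 3 (Pi.single 0 (3 * (R : ℤ))) := by
        rw [Finset.sum_const, nsmul_eq_mul]
    _ ≤ ∑ y ∈ S, criticalTwoPoint 3 y :=
        Finset.sum_le_sum fun y hy => criticalTwoPoint_axis_le_of_mem_box (mem_filter.1 hy).1

end Summit.CriticalPhenomena.Ising3DConformalLimit.Theorems
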